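import Summits.ValiantsHypothesis.ValiantsHypothesis.Theses.FeketeSOS

/-!
# `FeketeSOS.FeketeSOSHard` (stmt-ValiantsHypothesis-3996) — negative side: load-bearing hypotheses

Standing disprover (cdisprove, cycle 1), from `Cruxes/FeketeSOSHard/Disproof.lean` §(a).
Any proof of the crux must use
* that the modulus is PRIME (non-principality of `χ`): `feketeSOSHard_false_without_prime` — with the Jacobi
  symbol over all moduli the statement fails at every large prime square `N = q²`, where
  `∑_{m<N} J(m|N) x^m = (x + ⋯ + x^{q-1})(1 + x^q + ⋯ + x^{q(q-1)})` has a 4-square representation of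
  support-sum `< 4√N`;
* the VALUES of `χ_p`, not just "±1 on `[1,p-1]`, 0 at 0": `feketeSOSHard_false_without_legendre` — for every
  prime `p` the all-ones pattern `x + ⋯ + x^{p-1}` has a 4-square representation of support-sum `≤ 6√p + 4`
  (digit tiling `p − 1 = ab + r`, `a = ⌊√(p−1)⌋`), so the trivial bound `√(2p)` is tight up to a constant for
  full-support `±1` polynomials and the near-extremal covering structure of the supports carries no exponent.
Elementary (digit tilings, `PQ + MT` as four squares); no facts: the refuted VARIANTS are inlined in the two `¬ (…)`
statements (their inner block is the crux's, verbatim, with the target polynomial replaced); the `def`s are the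
witness polynomials. [folklore]
-/

namespace Summit.ValiantsHypothesis.ValiantsHypothesis.Theorems.FeketeSOSHard.Negative

open Polynomial Finset
open Summit.ValiantsHypothesis.ValiantsHypothesis.Theses.FeketeSOS

noncomputable section

/-- The four polynomials `P+Q, P-Q, M+T, M-T` of the two-products-are-four-squares identity. [folklore] -/
def sqg (P Q M T : ℂ[X]) : Fin 4 → ℂ[X] := ![P + Q, P - Q, M + T, M - T]

/-- The weights `1/4, -1/4, 1/4, -1/4`. [folklore] -/
def sqc : Fin 4 → ℂ := ![1 / 4, -1 / 4, 1 / 4, -1 / 4]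

/-- `PQ + MT = ¼(P+Q)² − ¼(P−Q)² + ¼(M+T)² − ¼(M−T)²` in the crux's format `∑ C(c i) * g i ^ 2`. -/
theorem sqg_sum (P Q M T : ℂ[X]) : (∑ i, C (sqc i) * sqg P Q M T i ^ 2) = P * Q + M * T := by
  have h4 : C (1 / 4 : ℂ) * 4 = 1 := by
    rw [show (4 : ℂ[X]) = C 4 from (map_ofNat C 4).symm, ← C_mul]; norm_num
  have hneg : C (-1 / 4 : ℂ) = -C (1 / 4 : ℂ) := by
    rw [← map_neg]; congr 1; ring
  simp only [Fin.sum_univ_four, sqg, sqc, Matrix.cons_val_zero, Matrix.cons_val_one, Matrix.cons_val_two,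
    Matrix.cons_val_three, Matrix.head_cons, Matrix.tail_cons, hneg]
  linear_combination (P * Q + M * T) * h4

/-- `|supp (P+Q)| ≤ |supp P| + |supp Q|`. -/
theorem card_support_add_le (P Q : ℂ[X]) :
    (P + Q).support.card ≤ P.support.card + Q.support.card :=
  (card_le_card support_add).trans (card_union_le _ _)

/-- `|supp (P−Q)| ≤ |supp P| + |supp Q|`. -/
theorem card_support_sub_le (P Q : ℂ[X]) :
    (P - Q).support.card ≤ P.support.card + Q.support.card := by
  have := card_support_add_le P (-Q); rwa [support_neg, ← sub_eq_add_neg] at this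

/-- Support-sum of the four squares is at most twice the supports of the four factors. -/
theorem sqg_support (P Q M T : ℂ[X]) :
    (∑ i, ((sqg P Q M T i).support.card : ℝ)) ≤
      2 * (P.support.card + Q.support.card + M.support.card + T.support.card) := by
  simp only [Fin.sum_univ_four, sqg, Matrix.cons_val_zero, Matrix.cons_val_one, Matrix.cons_val_two,
    Matrix.cons_val_three, Matrix.head_cons, Matrix.tail_cons]
  have e1 : ((P + Q).support.card : ℝ) ≤ P.support.card + Q.support.card := by
    exact_mod_cast card_support_add_le P Q
  have e2 : ((P - Q).support.card : ℝ) ≤ P.support.card + Q.support.card := by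
    exact_mod_cast card_support_sub_le P Q
  have e3 : ((M + T).support.card : ℝ) ≤ M.support.card + T.support.card := by
    exact_mod_cast card_support_add_le M T
  have e4 : ((M - T).support.card : ℝ) ≤ M.support.card + T.support.card := by
    exact_mod_cast card_support_sub_le M T
  linarith

/-- The four squares have degree at most the maximum degree of the four factors. -/
theorem sqg_natDegree (P Q M T : ℂ[X]) (D : ℕ) (hP : P.natDegree ≤ D) (hQ : Q.natDegree ≤ D)
    (hM : M.natDegree ≤ D) (hT : T.natDegree ≤ D) : ∀ i, (sqg P Q M T i).natDegree ≤ D := by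
  intro i
  fin_cases i
  · exact (natDegree_add_le _ _).trans (max_le hP hQ)
  · exact (natDegree_sub_le _ _).trans (max_le hP hQ)
  · exact (natDegree_add_le _ _).trans (max_le hM hT)
  · exact (natDegree_sub_le _ _).trans (max_le hM hT)

/-- Support of a finite sum of polynomials is at most the sum of the supports. -/
theorem card_support_sum_le {ι : Type*} (s : Finset ι) (f : ι → ℂ[X]) :
    (∑ i ∈ s, f i).support.card ≤ ∑ i ∈ s, (f i).support.card := by
  classical
  induction s using Finset.induction_on with
  | empty => simp
  | @insert a s ha ih =>
    rw [sum_insert ha, sum_insert ha]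
    exact (card_support_add_le _ _).trans (by omega)

/-- A monomial `X^n` has at most one term. -/
theorem card_support_X_pow_le (n : ℕ) : ((X : ℂ[X]) ^ n).support.card ≤ 1 := by
  rw [← one_mul (X ^ n), ← C_1]; exact card_support_C_mul_X_pow_le_one

/-- A sum of `|s|` monomials has at most `|s|` terms. -/
theorem card_support_sum_X_pow_le {ι : Type*} (s : Finset ι) (e : ι → ℕ) :
    (∑ i ∈ s, (X : ℂ[X]) ^ e i).support.card ≤ s.card := by
  refine (card_support_sum_le s _).trans ?_
  calc ∑ i ∈ s, ((X : ℂ[X]) ^ e i).support.card ≤ ∑ _i ∈ s, 1 :=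
        sum_le_sum fun i _ => card_support_X_pow_le (e i)
    _ = s.card := by simp

/-- Digit decomposition of `range (a*b)`: `m = k + a j`, `k < a`, `j < b`. -/
theorem sum_range_mul_eq {M : Type*} [AddCommMonoid M] (f : ℕ → M) (a b : ℕ) :
    ∑ m ∈ range (a * b), f m = ∑ j ∈ range b, ∑ k ∈ range a, f (k + a * j) := by
  induction b with
  | zero => simp
  | succ b ih =>
    rw [Nat.mul_succ, sum_range_add, ih, sum_range_succ]
    congr 1
    exact sum_congr rfl fun k _ => by rw [add_comm]

/-- The "Fekete polynomial" of an arbitrary modulus `N` with the Jacobi symbol, `∑_{m<N} J(m|N) X^m`;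
for prime `N` it is the crux's Fekete polynomial (`jacobiSym.legendreSym.to_jacobiSym`). [folklore] -/
def jacobiFekete (N : ℕ) : ℂ[X] := ∑ m ∈ range N, C ((jacobiSym m N : ℤ) : ℂ) * X ^ m

/-- `J(m | q²) = [q ∤ m]` for a prime `q`. -/
theorem jacobiSym_natCast_prime_sq (q : ℕ) [Fact q.Prime] (m : ℕ) :
    jacobiSym (m : ℤ) (q ^ 2) = if q ∣ m then 0 else 1 := by
  have : NeZero q := ⟨(Fact.out : q.Prime).ne_zero⟩
  rw [sq, jacobiSym.mul_right, ← jacobiSym.legendreSym.to_jacobiSym]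
  by_cases h : q ∣ m
  · have h0 : ((m : ℤ) : ZMod q) = 0 := by
      rw [Int.cast_natCast, ZMod.natCast_eq_zero_iff]; exact h
    rw [if_pos h, (legendreSym.eq_zero_iff q (m : ℤ)).mpr h0, zero_mul]
  · have h0 : ((m : ℤ) : ZMod q) ≠ 0 := by
      rw [Int.cast_natCast, Ne, ZMod.natCast_eq_zero_iff]; exact h
    rw [if_neg h, ← sq, legendreSym.sq_one q h0]

/-- low digits `x + x² + ⋯ + xⁿ`. [folklore] -/
def lowDigits (n : ℕ) : ℂ[X] := ∑ k ∈ range n, X ^ (k + 1)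
/-- high digits `∑_{j<b} x^{a j}`. [folklore] -/
def highDigits (a b : ℕ) : ℂ[X] := ∑ j ∈ range b, X ^ (a * j)

/-- `x + ⋯ + xⁿ` has at most `n` terms. -/
theorem card_support_lowDigits (n : ℕ) : (lowDigits n).support.card ≤ n := by
  unfold lowDigits; simpa using card_support_sum_X_pow_le (range n) (fun k => k + 1)

/-- `∑_{j<b} x^{aj}` has at most `b` terms. -/
theorem card_support_highDigits (a b : ℕ) : (highDigits a b).support.card ≤ b := by
  unfold highDigits; simpa using card_support_sum_X_pow_le (range b) (fun j => a * j)

/-- `deg (x + ⋯ + xⁿ) ≤ n`. -/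
theorem natDegree_lowDigits (n : ℕ) : (lowDigits n).natDegree ≤ n :=
  natDegree_sum_le_of_forall_le _ _ fun k hk => (natDegree_X_pow_le _).trans (by
    have := mem_range.mp hk; omega)

/-- `deg ∑_{j<b} x^{aj} ≤ ab`. -/
theorem natDegree_highDigits (a b : ℕ) : (highDigits a b).natDegree ≤ a * b :=
  natDegree_sum_le_of_forall_le _ _ fun j hj => (natDegree_X_pow_le _).trans (by
    have := mem_range.mp hj; exact Nat.mul_le_mul_left a this.le)

/-- The digit factorisation at a prime square:
`∑_{m<q²} J(m|q²) x^m = (x + ⋯ + x^{q-1}) · (1 + x^q + ⋯ + x^{q(q-1)})`. -/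
theorem jacobiFekete_prime_sq (n : ℕ) [Fact (n + 1).Prime] :
    jacobiFekete ((n + 1) ^ 2) = lowDigits n * highDigits (n + 1) (n + 1) := by
  unfold jacobiFekete lowDigits highDigits
  rw [sum_mul_sum, sq, sum_range_mul_eq, sum_comm, sum_range_succ']
  have h0 : ∑ j ∈ range (n + 1), C ((jacobiSym ((0 + (n + 1) * j : ℕ) : ℤ) ((n + 1) * (n + 1)) : ℤ) : ℂ) *
      X ^ (0 + (n + 1) * j) = 0 := by
    refine sum_eq_zero fun j _ => ?_
    rw [← sq, jacobiSym_natCast_prime_sq (n + 1), if_pos ⟨j, by ring⟩]; simp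
  rw [h0, add_zero]
  refine sum_congr rfl fun k hk => sum_congr rfl fun j _ => ?_
  have hk' : k < n := mem_range.mp hk
  have hnd : ¬ (n + 1) ∣ (k + 1) + (n + 1) * j := by
    rw [Nat.dvd_add_left ⟨j, rfl⟩]; exact Nat.not_dvd_of_pos_of_lt (Nat.succ_pos k) (by omega)
  rw [← sq, jacobiSym_natCast_prime_sq (n + 1) ((k + 1) + (n + 1) * j), if_neg hnd]
  simp [pow_add]

/-- **Primality (non-principality of `χ`) is load-bearing.**  At `N = q²` (`q` prime) the Jacobi–Fekete
polynomial is a product of two `q`-sparse polynomials, hence has a 4-square representation of support-sum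
`≤ 2(q-1) + 2q < 4q = 4√N` and degree `< N`; for every `δ > 0` this violates the bound `N^{1/2+δ}` as soon as
`q ≥ 4^{1/δ}` (then also `s = 4 ≤ N^δ`).  So the all-moduli (Jacobi) variant of the crux is false: any proof of the crux must use
that `p` is prime beyond "`(·|p)` is a real character, `±1` on units". [folklore; digit tiling] -/
theorem feketeSOSHard_false_without_prime :
    ¬ (∃ δ : ℝ, 0 < δ ∧ ∃ N₀ : ℕ, ∀ N : ℕ, N₀ ≤ N →
        ∀ (s : ℕ) (c : Fin s → ℂ) (g : Fin s → ℂ[X]), (s : ℝ) ≤ (N : ℝ) ^ δ →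
          (∀ i, (g i).natDegree ≤ N ^ 2) → (∑ i, C (c i) * g i ^ 2) = jacobiFekete N →
          (N : ℝ) ^ (1 / 2 + δ) ≤ ∑ i, ((g i).support.card : ℝ)) := by
  rintro ⟨δ, hδ, N₀, h⟩
  obtain ⟨q, hq, hqprime⟩ := Nat.exists_infinite_primes (max N₀ (⌈(4 : ℝ) ^ (1 / δ)⌉₊ + 1))
  haveI : Fact q.Prime := ⟨hqprime⟩
  obtain ⟨n, rfl⟩ : ∃ n, q = n + 1 := ⟨q - 1, (Nat.succ_pred_eq_of_pos hqprime.pos).symm⟩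
  have hN₀ : N₀ ≤ (n + 1) ^ 2 := le_trans (le_of_max_le_left hq) (Nat.le_self_pow two_ne_zero _)
  have key := h ((n + 1) ^ 2) hN₀ 4 sqc (sqg (lowDigits n) (highDigits (n + 1) (n + 1)) 0 0)
  have hq1 : (1 : ℝ) ≤ ((n + 1 : ℕ) : ℝ) := by exact_mod_cast Nat.succ_le_succ (Nat.zero_le n)
  have hq0 : (0 : ℝ) ≤ ((n + 1 : ℕ) : ℝ) := le_trans zero_le_one hq1
  have hceil : (4 : ℝ) ^ (1 / δ) ≤ ((n + 1 : ℕ) : ℝ) := by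
    have h1 : (⌈(4 : ℝ) ^ (1 / δ)⌉₊ : ℝ) ≤ ((n + 1 : ℕ) : ℝ) := by
      exact_mod_cast le_trans (Nat.le_succ _) (le_of_max_le_right hq)
    exact le_trans (Nat.le_ceil _) h1
  have hcast : (((n + 1) ^ 2 : ℕ) : ℝ) = ((n + 1 : ℕ) : ℝ) ^ (2 : ℕ) := by push_cast; ring
  have hqδ : (4 : ℝ) ≤ ((n + 1 : ℕ) : ℝ) ^ δ := by
    have : ((4 : ℝ) ^ (1 / δ)) ^ δ ≤ ((n + 1 : ℕ) : ℝ) ^ δ :=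
      Real.rpow_le_rpow (by positivity) hceil hδ.le
    rwa [← Real.rpow_mul (by norm_num), one_div_mul_cancel hδ.ne', Real.rpow_one] at this
  have hNδ : (4 : ℝ) ≤ (((n + 1) ^ 2 : ℕ) : ℝ) ^ δ := by
    refine le_trans hqδ (Real.rpow_le_rpow hq0 ?_ hδ.le)
    rw [hcast]; exact le_self_pow₀ hq1 two_ne_zero
  have hsplit : (((n + 1) ^ 2 : ℕ) : ℝ) ^ (1 / 2 + δ) =
      ((n + 1 : ℕ) : ℝ) * (((n + 1) ^ 2 : ℕ) : ℝ) ^ δ := by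
    rw [Real.rpow_add (by positivity), hcast, ← Real.rpow_natCast_mul hq0]
    norm_num
  have hs : ((4 : ℕ) : ℝ) ≤ (((n + 1) ^ 2 : ℕ) : ℝ) ^ δ := by exact_mod_cast hNδ
  have hpow1 : n + 1 ≤ ((n + 1) ^ 2) ^ 2 :=
    le_trans (Nat.le_self_pow two_ne_zero _) (Nat.le_self_pow two_ne_zero _)
  have hpow2 : (n + 1) * (n + 1) ≤ ((n + 1) ^ 2) ^ 2 := by
    rw [← sq]; exact Nat.le_self_pow two_ne_zero _
  have hdeg : ∀ i, (sqg (lowDigits n) (highDigits (n + 1) (n + 1)) 0 0 i).natDegree ≤ ((n + 1) ^ 2) ^ 2 := by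
    refine sqg_natDegree _ _ _ _ _ ?_ ?_ (by simp) (by simp)
    · exact (natDegree_lowDigits n).trans ((Nat.le_succ n).trans hpow1)
    · exact (natDegree_highDigits _ _).trans hpow2
  have hid : (∑ i, C (sqc i) * sqg (lowDigits n) (highDigits (n + 1) (n + 1)) 0 0 i ^ 2) =
      jacobiFekete ((n + 1) ^ 2) := by
    rw [sqg_sum, jacobiFekete_prime_sq, zero_mul, add_zero]
  have hbound := key hs hdeg hid
  have hsupp := sqg_support (lowDigits n) (highDigits (n + 1) (n + 1)) 0 0
  have hl : ((lowDigits n).support.card : ℝ) ≤ n := by exact_mod_cast card_support_lowDigits n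
  have hh : ((highDigits (n + 1) (n + 1)).support.card : ℝ) ≤ (n + 1 : ℕ) := by
    exact_mod_cast card_support_highDigits (n + 1) (n + 1)
  have hz : ((0 : ℂ[X]).support.card : ℝ) = 0 := by simp
  rw [hz] at hsupp
  rw [hsplit] at hbound
  have hq' : ((n + 1 : ℕ) : ℝ) = n + 1 := by push_cast; ring
  rw [hq'] at hbound hqδ hh
  have h4q : 4 * ((n : ℝ) + 1) ≤ ((n : ℝ) + 1) * (((n + 1) ^ 2 : ℕ) : ℝ) ^ δ := by nlinarith
  linarith

/-- The all-ones pattern `ε m = [m ≠ 0]`. [folklore] -/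
def onesPattern : ℕ → ℤ := fun m => if m = 0 then 0 else 1

/-- Digit tiling of `x + ⋯ + x^{ab+r}`:
`= (x + ⋯ + x^a)(∑_{j<b} x^{aj}) + x^{ab+1}(1 + ⋯ + x^{r-1})`. -/
theorem ones_digit_identity (a b r : ℕ) :
    (∑ m ∈ range (a * b + r), (X : ℂ[X]) ^ (m + 1)) =
      lowDigits a * highDigits a b + X ^ (a * b + 1) * ∑ k ∈ range r, X ^ k := by
  unfold lowDigits highDigits
  rw [sum_range_add, sum_mul_sum, sum_range_mul_eq, mul_sum]
  refine congrArg₂ (· + ·) ?_ ?_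
  · rw [sum_comm]
    refine sum_congr rfl fun k _ => sum_congr rfl fun j _ => ?_
    rw [← pow_add, show k + a * j + 1 = (k + 1) + a * j by ring]
  · refine sum_congr rfl fun k _ => ?_
    rw [← pow_add, show a * b + k + 1 = (a * b + 1) + k by ring]

/-- The all-ones pattern renders as `x + x² + ⋯ + x^N`. -/
theorem ones_poly_eq (N : ℕ) :
    (∑ m ∈ range (N + 1), C ((onesPattern m : ℤ) : ℂ) * X ^ m) = ∑ m ∈ range N, (X : ℂ[X]) ^ (m + 1) := by
  rw [sum_range_succ']
  simp [onesPattern]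

/-- **The values of `χ_p` are load-bearing.**  For EVERY prime `p` the all-ones polynomial
`x + x² + ⋯ + x^{p-1}` (a legal sign pattern: full support `[1,p-1]`, coefficients `±1`) has the 4-square
representation `sqg (lowDigits a) (highDigits a b) (x^{ab+1}) (1 + ⋯ + x^{r-1})` with `a = ⌊√(p-1)⌋`,
`p - 1 = ab + r`, of support-sum `≤ 2(a + b + 1 + r) ≤ 6a + 4 ≤ 10√p < p^{1/2+δ}` once `p^δ ≥ 12`.
So the all-sign-patterns variant of the crux is false and the trivial counting bound `√(2p)` is tight up to a constant for
full-support `±1` polynomials of every prime length: the exponent gain in the crux cannot come from the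
covering combinatorics of `[1,p-1]` by few sumsets alone — it must come from the values of `χ_p`. [folklore] -/
theorem feketeSOSHard_false_without_legendre :
    ¬ (∃ δ : ℝ, 0 < δ ∧ ∃ p₀ : ℕ, ∀ (p : ℕ) [Fact p.Prime], p₀ ≤ p → ∀ ε : ℕ → ℤ, ε 0 = 0 →
        (∀ m, 0 < m → m < p → (ε m = 1 ∨ ε m = -1)) →
        ∀ (s : ℕ) (c : Fin s → ℂ) (g : Fin s → ℂ[X]), (s : ℝ) ≤ (p : ℝ) ^ δ →
          (∀ i, (g i).natDegree ≤ p ^ 2) →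
          (∑ i, C (c i) * g i ^ 2) = ∑ m ∈ range p, C ((ε m : ℤ) : ℂ) * X ^ m →
          (p : ℝ) ^ (1 / 2 + δ) ≤ ∑ i, ((g i).support.card : ℝ)) := by
  rintro ⟨δ, hδ, p₀, h⟩
  obtain ⟨p, hp, hpprime⟩ := Nat.exists_infinite_primes (max p₀ (⌈(12 : ℝ) ^ (1 / δ)⌉₊ + 2))
  haveI : Fact p.Prime := ⟨hpprime⟩
  obtain ⟨N, rfl⟩ : ∃ N, p = N + 1 := ⟨p - 1, (Nat.succ_pred_eq_of_pos hpprime.pos).symm⟩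
  -- digits of N = p - 1 : N = a * b + r, a = ⌊√N⌋
  set a := Nat.sqrt N with ha
  set b := N / a with hb
  set r := N % a with hr
  have hN1 : 1 ≤ N := by have := hpprime.two_le; omega
  have ha1 : 1 ≤ a := by rw [ha]; exact Nat.le_sqrt.mpr (by simpa using hN1)
  have hNabr : N = a * b + r := by rw [hb, hr]; exact (Nat.div_add_mod N a).symm
  have hra : r < a := by rw [hr]; exact Nat.mod_lt _ ha1
  have haa : a * a ≤ N := by rw [ha]; exact Nat.sqrt_le N
  have hNlt : N < (a + 1) * (a + 1) := by rw [ha]; exact Nat.lt_succ_sqrt N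
  have hb_le : b ≤ a + 2 := by
    rw [hb]
    have : N ≤ a * (a + 2) := by nlinarith
    calc N / a ≤ (a * (a + 2)) / a := Nat.div_le_div_right this
      _ = a + 2 := Nat.mul_div_cancel_left _ ha1
  have hab : a * b ≤ N := hNabr ▸ Nat.le_add_right _ _
  have hrN : r ≤ N := hNabr ▸ Nat.le_add_left _ _
  have haN : a ≤ N := (Nat.le_mul_self a).trans haa
  have hsq : N + 1 ≤ (N + 1) ^ 2 := Nat.le_self_pow two_ne_zero _
  -- the witness
  set T : ℂ[X] := ∑ k ∈ range r, X ^ k with hT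
  set M : ℂ[X] := X ^ (a * b + 1) with hM
  have key := h (N + 1) (le_trans (le_of_max_le_left hp) le_rfl) onesPattern rfl
    (fun m hm _ => by simp [onesPattern, hm.ne']) 4 sqc (sqg (lowDigits a) (highDigits a b) M T)
  -- reals
  have hp1 : (1 : ℝ) ≤ ((N + 1 : ℕ) : ℝ) := by exact_mod_cast Nat.succ_le_succ (Nat.zero_le N)
  have hp0 : (0 : ℝ) < ((N + 1 : ℕ) : ℝ) := lt_of_lt_of_le zero_lt_one hp1
  have hceil : (12 : ℝ) ^ (1 / δ) ≤ ((N + 1 : ℕ) : ℝ) := by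
    have h1 : (⌈(12 : ℝ) ^ (1 / δ)⌉₊ : ℝ) ≤ ((N + 1 : ℕ) : ℝ) := by
      have : ⌈(12 : ℝ) ^ (1 / δ)⌉₊ ≤ N + 1 := le_trans (by omega) (le_of_max_le_right hp)
      exact_mod_cast this
    exact le_trans (Nat.le_ceil _) h1
  have hpδ : (12 : ℝ) ≤ ((N + 1 : ℕ) : ℝ) ^ δ := by
    have : ((12 : ℝ) ^ (1 / δ)) ^ δ ≤ ((N + 1 : ℕ) : ℝ) ^ δ :=
      Real.rpow_le_rpow (by positivity) hceil hδ.le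
    rwa [← Real.rpow_mul (by norm_num), one_div_mul_cancel hδ.ne', Real.rpow_one] at this
  have hs : ((4 : ℕ) : ℝ) ≤ ((N + 1 : ℕ) : ℝ) ^ δ := le_trans (by norm_num) hpδ
  have hsplit : ((N + 1 : ℕ) : ℝ) ^ (1 / 2 + δ) = Real.sqrt ((N + 1 : ℕ) : ℝ) * ((N + 1 : ℕ) : ℝ) ^ δ := by
    rw [Real.rpow_add hp0, ← Real.sqrt_eq_rpow]
  -- degrees
  have hdeg : ∀ i, (sqg (lowDigits a) (highDigits a b) M T i).natDegree ≤ (N + 1) ^ 2 := by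
    refine sqg_natDegree _ _ _ _ _ ?_ ?_ ?_ ?_
    · exact (natDegree_lowDigits a).trans (by omega)
    · exact (natDegree_highDigits a b).trans (by omega)
    · rw [hM]; exact (natDegree_X_pow_le _).trans (by omega)
    · rw [hT]
      exact natDegree_sum_le_of_forall_le _ _ fun k hk => (natDegree_X_pow_le _).trans (by
        have := mem_range.mp hk; omega)
  -- the identity
  have hid : (∑ i, C (sqc i) * sqg (lowDigits a) (highDigits a b) M T i ^ 2) =
      ∑ m ∈ range (N + 1), C ((onesPattern m : ℤ) : ℂ) * X ^ m := by
    rw [sqg_sum, ones_poly_eq, hM, hT]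
    conv_rhs => rw [hNabr]
    rw [ones_digit_identity]
  have hbound := key hs hdeg hid
  -- support-sum bookkeeping
  have hsupp := sqg_support (lowDigits a) (highDigits a b) M T
  have hl : ((lowDigits a).support.card : ℝ) ≤ a := by exact_mod_cast card_support_lowDigits a
  have hh : ((highDigits a b).support.card : ℝ) ≤ b := by exact_mod_cast card_support_highDigits a b
  have hMc : (M.support.card : ℝ) ≤ 1 := by rw [hM]; exact_mod_cast card_support_X_pow_le _
  have hTc : (T.support.card : ℝ) ≤ r := by
    have : T.support.card ≤ r := by
      rw [hT]; exact (card_support_sum_X_pow_le (range r) id).trans (by simp)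
    exact_mod_cast this
  have hb' : (b : ℝ) ≤ a + 2 := by exact_mod_cast hb_le
  have hr' : (r : ℝ) + 1 ≤ a := by
    have : r + 1 ≤ a := hra
    exact_mod_cast this
  have hsqrt : (a : ℝ) ≤ Real.sqrt ((N + 1 : ℕ) : ℝ) := by
    rw [← Real.sqrt_sq (Nat.cast_nonneg a)]
    apply Real.sqrt_le_sqrt
    have : ((a * a : ℕ) : ℝ) ≤ ((N + 1 : ℕ) : ℝ) := by exact_mod_cast haa.trans (Nat.le_succ N)
    push_cast at this ⊢; nlinarith
  have hsqrt1 : (1 : ℝ) ≤ Real.sqrt ((N + 1 : ℕ) : ℝ) := by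
    rw [← Real.sqrt_one]; exact Real.sqrt_le_sqrt hp1
  rw [hsplit] at hbound
  set S := ∑ i, ((sqg (lowDigits a) (highDigits a b) M T i).support.card : ℝ) with hS
  set sq := Real.sqrt ((N + 1 : ℕ) : ℝ) with hsqdef
  set pδ := ((N + 1 : ℕ) : ℝ) ^ δ with hpδdef
  have h1 : S ≤ 10 * sq := by linarith
  have h2 : 12 * sq ≤ sq * pδ := by nlinarith
  linarith

end

end Summit.ValiantsHypothesis.ValiantsHypothesis.Theorems.FeketeSOSHard.Negative
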